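import Summits.FinalStateConjecture.FinalStateConjecture.Theorems.PhotonSphereChannelsChannelsResolveTameDevelopmentsRTrappedSetMinkowskiLimit
import Literature.Geometry.Lorentzian.LorentzBoost
import HarnessLib

/-!
# Hypothesis (ii) of the crux K2R ≡ Φ is LORENTZ-PANCAKE-BLIND: tame `r₀`-charts may be boosted, so the
# clause bounds no injectivity radius — support (negative side) for the crux `ChannelsResolveTameDevelopmentsR`
# (item `stmt-FinalStateConjecture-17430`, route PhotonSphereChannels), load-bearing analysis of hypothesis (ii)

Hypothesis (ii) of the crux ("bounded geometry of the outer region at a uniform scale") asks, at every outer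
point `q`, for SOME smooth open embedding `Ψ` of the coordinate ball `B(0, r₀) ⊆ E4` with `Ψ(0) = q`,
`sup_{C³} ‖Ψ^* g − η‖ ≤ Λ` and `sup_{C⁰} ‖Ψ^* g − η‖ ≤ 1/2` — in ANY frame: nothing ties the chart's time
axis `dΨ(∂₀)` to the clock of the data. This file records, kernel-checked, the consequence: **(ii) is
satisfied at every scale `r₀` by a flat spacetime with closed spacelike geodesics of any length `L` through
every point**, the flat cylinder `E4/(Lℤ e₃)`, read on its universal cover `(E4, η)`:

* `boost_pancake_component` — the algebra: if the pure boost `Λ_v` along `e₃` with Lorentz factor `γ` maps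
  `z` to the purely spatial vector `(0, m e₃)`, then `z₃ = γ m` (so a short deck vector has a LONG preimage);
* `exists_boost_image_ball_disjoint_translates` — for all `r₀, L > 0` there is `Λ ∈ lorentzGroup` (the boost
  with `γ = max (2r₀/L) 1`) such that the pancake `Λ(B(0, r₀))` is disjoint from ALL its translates by
  `k L e₃`, `k ∈ ℤ ∖ {0}`: the covering-space form of "the boosted ball chart descends INJECTIVELY to the
  cylinder of circumference `L`", however small `L/r₀` is;
* `isLateChart_minkowski_affine`, `deviationExtend_minkowski_affine` — for every `Λ ∈ lorentzGroup` and
  `q`, the affine chart `x ↦ q + Λ x` of the ball is a late chart of Minkowski spacetime with deviation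
  IDENTICALLY ZERO (so `sup_{C³} = sup_{C⁰} = 0`);
* `tame_charts_boost_blind` — the package, in the words of clause (ii): at every point `q` of Minkowski
  space and for every `r₀, L > 0` there is a chart satisfying (ii)'s four conjuncts verbatim (with `Λ = 0`)
  whose image `q + Λ(B(0,r₀))` meets none of its non-trivial `Lℤ e₃`-translates.

Reading. A Lorentzian metric has no canonical Riemannian "size": the `C³`-bounded, `C⁰`-pinched ball of
(ii) may be an arbitrarily thin pancake in a null direction. Hence (ii) as typed does NOT give bounded
geometry in the sense of Anderson's Lorentzian Cheeger–Gromov theory (charts adapted to a time function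
with lapse bounds; cf. the tree's clock-adapted notion `TrappedSet.TameClockChartAt`), it does not bound
the injectivity radius of the `Σ`-time slices, and no stub may extract NON-COLLAPSE from it. For the crux
this WEAKENS the hypothesis — more developments qualify as tame (e.g. expanding Kasner-type bags with a
contracting cycle, relevant to the hidden-bag exposure of the T2 ray-closure clause, crux dossier §8) —
and is information for planners (a clock-adapted restatement of (ii)) rather than a refutation.

All results proved; no named facts; axioms `propext`, `Classical.choice`, `Quot.sound`.

## References

* B. O'Neill, *Semi-Riemannian geometry* (1983), Ch. 9, pp. 233–236 (boosts, `O(1,3)`).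
* M. T. Anderson, *Cheeger–Gromov theory and applications to general relativity* (2004), §1.
* M. Dafermos, G. Holzegel, I. Rodnianski, M. Taylor, arXiv:2104.08222, §1 (charts and deviations).
-/

noncomputable section

open Set Metric Filter Topology Function TopologicalSpace
open scoped Manifold ContDiff Topology ENNReal NNReal RealInnerProductSpace

set_option linter.dupNamespace false

namespace Summit.FinalStateConjecture.FinalStateConjecture.Theorems.ChannelsResolveTameDevelopmentsR.Negative

open Literature.Geometry.Lorentzian Literature.Geometry.Lorentzian.Lorentz

/-! ## §1 The algebra of the pancake: a short spatial deck vector has a long boost-preimage -/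

/-- `‖e₃‖ = 1` (private copy of `Literature.Barriers.FinalStateConjecture.norm_single_two`, to keep the
import cone of this file inside the Lorentzian prelude). -/
private theorem norm_e3 : ‖(EuclideanSpace.single (2 : Fin 3) (1 : ℝ) : E3)‖ = 1 := by
  simp

/-- `⟪e₃, w⟫ = w₃`. -/
theorem inner_e3_left (w : E3) : ⟪(EuclideanSpace.single (2 : Fin 3) (1 : ℝ) : E3), w⟫ = w 2 := by
  rw [EuclideanSpace.inner_single_left]
  simp

/-- **The pancake component identity.** Let `v = s e₃` with `‖v‖ < 1` and Lorentz factor `γ = γ(v)`.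
If the boost `Λ_v` maps `z ∈ E4` to the purely spatial vector `(0, m e₃)`, then the third spatial
component of `z` is `γ m`. (Time component: `z⁰ = −s z₃`; `e₃`-component of the spatial part:
`z₃ (1 + (γ²/(γ+1) − γ) s²) = m`; and `γ²(1 − s²) = 1` makes the bracket `1/γ`.) -/
theorem boost_pancake_component {s : ℝ} (hv : ‖s • (EuclideanSpace.single (2 : Fin 3) (1 : ℝ) : E3)‖ < 1) {z : E4} {m : ℝ}
    (h : boostCLM (s • (EuclideanSpace.single (2 : Fin 3) (1 : ℝ) : E3)) z = E4.ofTimeSpace 0 (m • (EuclideanSpace.single (2 : Fin 3) (1 : ℝ) : E3))) :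
    E4.spatial z 2 = gamma (s • (EuclideanSpace.single (2 : Fin 3) (1 : ℝ) : E3)) * m := by
  set v : E3 := s • (EuclideanSpace.single (2 : Fin 3) (1 : ℝ) : E3) with hvdef
  set γ : ℝ := gamma v with hγ
  have hγpos : 0 < γ := gamma_pos hv
  have hvz : ⟪v, E4.spatial z⟫ = s * E4.spatial z 2 := by
    rw [hvdef, real_inner_smul_left, inner_e3_left]
  have hnorm : ‖v‖ ^ 2 = s ^ 2 := by
    rw [hvdef, norm_smul, norm_e3, mul_one, Real.norm_eq_abs, sq_abs]
  have hG : γ ^ 2 * (1 - s ^ 2) = 1 := by rw [← hnorm]; exact gamma_sq_mul hv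
  -- time component: `γ (z⁰ + ⟪v, z̃⟫) = 0`
  have h0 : z 0 + ⟪v, E4.spatial z⟫ = 0 := by
    have := congrArg (fun x : E4 ↦ x 0) h
    simp only [boostCLM_apply_zero, E4.ofTimeSpace_apply_zero] at this
    rcases mul_eq_zero.1 this with h1 | h1
    · exact absurd h1 hγpos.ne'
    · exact h1
  -- spatial part, third component
  have hsp : E4.spatial z + (γ ^ 2 / (γ + 1) * ⟪v, E4.spatial z⟫ + γ * z 0) • v = m • (EuclideanSpace.single (2 : Fin 3) (1 : ℝ) : E3) := by
    have := congrArg E4.spatial h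
    rwa [spatial_boostCLM_apply, E4.spatial_ofTimeSpace] at this
  have hv2 : v 2 = s := by simp [hvdef]
  have ha2 : (EuclideanSpace.single (2 : Fin 3) (1 : ℝ) : E3) 2 = 1 := by simp
  have hE : E4.spatial z 2 + (γ ^ 2 / (γ + 1) * ⟪v, E4.spatial z⟫ + γ * z 0) * s = m := by
    have := congrArg (fun w : E3 ↦ w 2) hsp
    simp only [PiLp.add_apply, PiLp.smul_apply, smul_eq_mul, hv2, ha2, mul_one] at this
    linear_combination this
  rw [hvz] at hE h0
  set z2 : ℝ := E4.spatial z 2 with hz2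
  have hz0 : z 0 = -(s * z2) := by linarith
  set A : ℝ := γ ^ 2 / (γ + 1) with hAdef
  have hA : A * (γ + 1) = γ ^ 2 := div_mul_cancel₀ _ (by positivity)
  -- clear denominators by hand: `(γ + 1) (z2 − γ m) = 0`
  have key : (γ + 1) * (z2 - γ * m) = 0 := by
    linear_combination (γ * (γ + 1)) * hE + (-(γ * s ^ 2 * z2)) * hA +
      (-(γ ^ 2 * (γ + 1) * s)) * hz0 + (-z2) * hG
  have hne : (γ + 1) ≠ 0 := by positivity
  have := (mul_eq_zero.1 key).resolve_left hne
  linarith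

/-- The Lorentz factor is prescribed by the speed: for `G ≥ 1` and `s = √(1 − G⁻²)`, `‖s e₃‖ < 1` … -/
theorem norm_speed_e3_lt {G : ℝ} (hG : 1 ≤ G) : ‖Real.sqrt (1 - (G⁻¹) ^ 2) • (EuclideanSpace.single (2 : Fin 3) (1 : ℝ) : E3)‖ < 1 := by
  have hGpos : 0 < G := by linarith
  have hi : 0 < (G⁻¹) ^ 2 := by positivity
  have hle : (G⁻¹) ^ 2 ≤ 1 := by
    rw [inv_pow]
    exact inv_le_one_of_one_le₀ (by nlinarith)
  rw [norm_smul, norm_e3, mul_one, Real.norm_eq_abs, abs_of_nonneg (Real.sqrt_nonneg _),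
    Real.sqrt_lt' one_pos]
  linarith

/-- … and `γ(s e₃) = G`. -/
theorem gamma_speed_e3 {G : ℝ} (hG : 1 ≤ G) : gamma (Real.sqrt (1 - (G⁻¹) ^ 2) • (EuclideanSpace.single (2 : Fin 3) (1 : ℝ) : E3)) = G := by
  have hGpos : 0 < G := by linarith
  have hle : (G⁻¹) ^ 2 ≤ 1 := by
    rw [inv_pow]
    exact inv_le_one_of_one_le₀ (by nlinarith)
  unfold gamma
  rw [norm_smul, norm_e3, mul_one, Real.norm_eq_abs, sq_abs, Real.sq_sqrt (by linarith),
    show (1 : ℝ) - (1 - (G⁻¹) ^ 2) = (G⁻¹) ^ 2 by ring, Real.sqrt_sq (by positivity), inv_inv]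

/-- **The pancake misses all its deck translates.** For all `r₀, L > 0` there is `Λ ∈ lorentzGroup` — the
boost along `e₃` with Lorentz factor `γ = max (2r₀/L) 1` — such that `Λ(B(0, r₀))` is disjoint from
`Λ(B(0, r₀)) + k L e₃` for every integer `k ≠ 0`: a preimage difference `z = a − b`, `‖z‖ < 2r₀`, with
`Λ z = k L e₃` would have `|z₃| = γ |k| L ≥ 2r₀`. Equivalently: the exactly flat chart `Λ|_{B(0,r₀)}`
descends injectively to the flat cylinder `E4/(Lℤ e₃)`, whose closed spacelike geodesics have length `L`,
for EVERY ratio `r₀/L`. -/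
theorem exists_boost_image_ball_disjoint_translates {r₀ L : ℝ} (hr₀ : 0 < r₀) (hL : 0 < L) :
    ∃ Λ : lorentzGroup, ∀ k : ℤ, k ≠ 0 →
      Disjoint ((Λ : E4 ≃L[ℝ] E4) '' ball (0 : E4) r₀)
        ((fun x ↦ x + E4.ofTimeSpace 0 (((k : ℝ) * L) • (EuclideanSpace.single (2 : Fin 3) (1 : ℝ) : E3))) '' ((Λ : E4 ≃L[ℝ] E4) '' ball (0 : E4) r₀)) := by
  set G : ℝ := max (2 * r₀ / L) 1 with hGdef
  have hG : 1 ≤ G := le_max_right _ _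
  set s : ℝ := Real.sqrt (1 - (G⁻¹) ^ 2) with hsdef
  have hv : ‖s • (EuclideanSpace.single (2 : Fin 3) (1 : ℝ) : E3)‖ < 1 := norm_speed_e3_lt hG
  have hγ : gamma (s • (EuclideanSpace.single (2 : Fin 3) (1 : ℝ) : E3)) = G := gamma_speed_e3 hG
  refine ⟨boost (s • (EuclideanSpace.single (2 : Fin 3) (1 : ℝ) : E3)) hv, fun k hk ↦ ?_⟩
  rw [Set.disjoint_left]
  rintro x ⟨a, ha, rfl⟩ ⟨y, ⟨b, hb, rfl⟩, hxy⟩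
  -- `Λ a = Λ b + deck`, so `Λ (a - b) = deck`
  have hxy' : (boost (s • (EuclideanSpace.single (2 : Fin 3) (1 : ℝ) : E3)) hv : E4 ≃L[ℝ] E4) b + E4.ofTimeSpace 0 (((k : ℝ) * L) • (EuclideanSpace.single (2 : Fin 3) (1 : ℝ) : E3)) = (boost (s • (EuclideanSpace.single (2 : Fin 3) (1 : ℝ) : E3)) hv : E4 ≃L[ℝ] E4) a :=
    hxy
  have hz : boostCLM (s • (EuclideanSpace.single (2 : Fin 3) (1 : ℝ) : E3)) (a - b) = E4.ofTimeSpace 0 (((k : ℝ) * L) • (EuclideanSpace.single (2 : Fin 3) (1 : ℝ) : E3)) := by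
    have h1 : (boost (s • (EuclideanSpace.single (2 : Fin 3) (1 : ℝ) : E3)) hv : E4 ≃L[ℝ] E4) a - (boost (s • (EuclideanSpace.single (2 : Fin 3) (1 : ℝ) : E3)) hv : E4 ≃L[ℝ] E4) b = E4.ofTimeSpace 0 (((k : ℝ) * L) • (EuclideanSpace.single (2 : Fin 3) (1 : ℝ) : E3)) := by
      rw [← hxy', add_sub_cancel_left]
    rw [← map_sub] at h1
    simpa using h1
  have hcomp := boost_pancake_component hv hz
  rw [hγ] at hcomp
  -- `|z₃| ≤ ‖z‖ < 2 r₀` but `|γ k L| ≥ G L ≥ 2 r₀`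
  have hzn : ‖a - b‖ < 2 * r₀ := by
    rw [mem_ball_zero_iff] at ha hb
    calc ‖a - b‖ ≤ ‖a‖ + ‖b‖ := norm_sub_le a b
      _ < r₀ + r₀ := add_lt_add ha hb
      _ = 2 * r₀ := by ring
  have h3 : |E4.spatial (a - b) 2| ≤ ‖a - b‖ := by
    rw [E4.spatial_apply]
    have := PiLp.norm_apply_le (a - b) (2 : Fin 3).succ
    rwa [Real.norm_eq_abs] at this
  have hk1 : (1 : ℝ) ≤ |(k : ℝ)| := by
    rw [← Int.cast_abs]
    exact_mod_cast Int.one_le_abs hk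
  have hGL : 2 * r₀ ≤ G * L := by
    have : 2 * r₀ / L ≤ G := le_max_left _ _
    rwa [div_le_iff₀ hL] at this
  have habs : |G * ((k : ℝ) * L)| = G * L * |(k : ℝ)| := by
    rw [abs_mul, abs_mul, abs_of_pos (lt_of_lt_of_le one_pos hG), abs_of_pos hL]; ring
  have hge : 2 * r₀ ≤ |E4.spatial (a - b) 2| := by
    rw [hcomp, habs]
    nlinarith [mul_pos (lt_of_lt_of_le one_pos hG) hL]
  linarith

/-! ## §2 Boosted affine charts of Minkowski spacetime are exactly flat late charts -/

/-- The differential of the affine map `x ↦ q + Λ x` of an open `U ⊆ E4` is `Λ`. -/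
theorem mfderiv_affine_subtypeVal_apply (U : Opens E4) (Λ : lorentzGroup) (q : E4) (x : U) (v : E4) :
    mfderiv 𝓘(ℝ, E4) (𝓡 4) (fun y : U ↦ q + (Λ : E4 ≃L[ℝ] E4) (y : E4)) x v = (Λ : E4 ≃L[ℝ] E4) v := by
  have h1 : HasMFDerivAt 𝓘(ℝ, E4) 𝓘(ℝ, E4) (fun y : E4 ↦ q + (Λ : E4 ≃L[ℝ] E4) y) (x : E4)
      ((Λ : E4 ≃L[ℝ] E4) : E4 →L[ℝ] E4) :=
    (((Λ : E4 ≃L[ℝ] E4) : E4 →L[ℝ] E4).hasFDerivAt.const_add q).hasMFDerivAt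
  have h2 : MDifferentiableAt 𝓘(ℝ, E4) 𝓘(ℝ, E4) (Subtype.val : U → E4) x :=
    (contMDiff_subtype_val (I := 𝓘(ℝ, E4)) (n := ∞)).mdifferentiableAt (by simp)
  have h3 := DFunLike.congr_fun (h1.comp x h2.hasMFDerivAt).mfderiv v
  have e1 := OpensChart.mfderiv_subtypeVal_apply x v
  refine h3.trans ?_
  change ((Λ : E4 ≃L[ℝ] E4) : E4 →L[ℝ] E4) (mfderiv 𝓘(ℝ, E4) 𝓘(ℝ, E4) (Subtype.val : U → E4) x v) = _
  rw [e1]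
  rfl

/-- The affine chart `x ↦ q + Λ x`, `Λ ∈ lorentzGroup`, has vanishing deviation from the Minkowski
background (`η(Λ v, Λ w) = η(v, w)`). -/
theorem deviation_minkowski_affine (U : Opens E4) (Λ : lorentzGroup) (q : E4) (x : U) :
    Minkowski.spacetime.deviation (Minkowski.backgroundOn U)
      (fun y : U ↦ q + (Λ : E4 ≃L[ℝ] E4) (y : E4)) x = 0 := by
  ext v w
  change Minkowski.bilin (mfderiv 𝓘(ℝ, E4) (𝓡 4) (fun y : U ↦ q + (Λ : E4 ≃L[ℝ] E4) (y : E4)) x v)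
      (mfderiv 𝓘(ℝ, E4) (𝓡 4) (fun y : U ↦ q + (Λ : E4 ≃L[ℝ] E4) (y : E4)) x w) - Minkowski.bilin v w = 0
  rw [mfderiv_affine_subtypeVal_apply, mfderiv_affine_subtypeVal_apply, Λ.2 v w, sub_self]

/-- Hence its extended deviation vanishes identically. -/
theorem deviationExtend_minkowski_affine (U : Opens E4) (Λ : lorentzGroup) (q : E4) :
    Minkowski.spacetime.deviationExtend (Minkowski.backgroundOn U)
      (fun y : U ↦ q + (Λ : E4 ≃L[ℝ] E4) (y : E4)) = 0 := by
  funext y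
  by_cases hy : y ∈ U
  · have := Minkowski.spacetime.deviationExtend_coe (Minkowski.backgroundOn U)
      (fun y : U ↦ q + (Λ : E4 ≃L[ℝ] E4) (y : E4)) ⟨y, hy⟩
    rw [deviation_minkowski_affine] at this
    exact this
  · have h : ¬ ∃ a : U, (a : E4) = y := fun ⟨a, ha⟩ ↦ hy (ha ▸ a.2)
    exact Function.extend_apply' _ _ _ h

/-- The affine chart of the coordinate ball `B(0, r₀)` is a late-time chart of Minkowski spacetime on the
Minkowski background over the ball, after time `−r₀` (smooth; open embedding; image in `univ`). -/
theorem isLateChart_minkowski_affine (r₀ : ℝ) (Λ : lorentzGroup) (q : E4) :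
    Minkowski.spacetime.IsLateChart
      (Minkowski.backgroundOn ⟨ball (0 : E4) r₀, isOpen_ball⟩) univ (-r₀)
      (fun y : (⟨ball (0 : E4) r₀, isOpen_ball⟩ : Opens E4) ↦ q + (Λ : E4 ≃L[ℝ] E4) (y : E4)) := by
  set U : Opens E4 := ⟨ball (0 : E4) r₀, isOpen_ball⟩
  refine ⟨?_, ?_, fun _ _ ↦ trivial⟩
  · exact (contMDiff_iff_contDiff.mpr (contDiff_const.add (Λ : E4 ≃L[ℝ] E4).contDiff) :
        ContMDiff 𝓘(ℝ, E4) 𝓘(ℝ, E4) ∞ fun y : E4 ↦ q + (Λ : E4 ≃L[ℝ] E4) y).comp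
      (contMDiff_subtype_val (I := 𝓘(ℝ, E4)) (n := ∞))
  · have hlate : IsOpen ((Minkowski.backgroundOn U).lateRegion (-r₀)) :=
      isOpen_lt continuous_const ((PiLp.continuous_apply 2 _ 0).comp continuous_subtype_val)
    exact (Homeomorph.addLeft q).isOpenEmbedding.comp
      ((Λ : E4 ≃L[ℝ] E4).toHomeomorph.isOpenEmbedding.comp
        ((IsOpen.isOpenEmbedding_subtypeVal U.isOpen).comp (IsOpen.isOpenEmbedding_subtypeVal hlate)))

/-! ## §3 The package, in the words of hypothesis (ii) -/

/-- **Hypothesis (ii) is Lorentz-pancake-blind.** For every `r₀ > 0`, `L > 0` there is `Λ ∈ lorentzGroup`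
such that, at EVERY point `q` of Minkowski spacetime, the chart `Ψ(x) = q + Λ x` of the coordinate ball
`U = B(0, r₀)` satisfies the four conjuncts of clause (ii) of the crux verbatim — late chart after `−r₀`,
centred (`Ψ 0 = q`), `sup_{C³}` of the deviation `≤ 0`, `sup_{C⁰} ≤ 1/2` — while its image
`q + Λ(B(0, r₀))` is disjoint from all its translates by `k L e₃`, `k ≠ 0`: it descends to an embedded,
exactly flat `r₀`-chart of the flat cylinder `E4/(Lℤ e₃)`, in which every point lies on a closed spacelike
geodesic of length `L`. So (ii) at scale `r₀` is compatible with collapse at any scale `L ≪ r₀`. -/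
theorem tame_charts_boost_blind {r₀ L : ℝ} (hr₀ : 0 < r₀) (hL : 0 < L) :
    ∃ Λ : lorentzGroup,
      (∀ k : ℤ, k ≠ 0 →
        Disjoint ((Λ : E4 ≃L[ℝ] E4) '' ball (0 : E4) r₀)
          ((fun x ↦ x + E4.ofTimeSpace 0 (((k : ℝ) * L) • (EuclideanSpace.single (2 : Fin 3) (1 : ℝ) : E3))) '' ((Λ : E4 ≃L[ℝ] E4) '' ball (0 : E4) r₀))) ∧
      ∀ q : E4,
        let U : Opens E4 := ⟨ball (0 : E4) r₀, isOpen_ball⟩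
        ∃ Ψ : U → E4,
          Minkowski.spacetime.IsLateChart (Minkowski.backgroundOn U) univ (-r₀) Ψ ∧
          (∃ x : U, (x : E4) = 0 ∧ Ψ x = q) ∧
          supCkENorm (U : Set E4) 3 (Minkowski.spacetime.deviationExtend (Minkowski.backgroundOn U) Ψ) ≤ 0 ∧
          supCkENorm (U : Set E4) 0 (Minkowski.spacetime.deviationExtend (Minkowski.backgroundOn U) Ψ)
            ≤ 1 / 2 ∧
          range Ψ = (fun x ↦ q + x) '' ((Λ : E4 ≃L[ℝ] E4) '' ball (0 : E4) r₀) := by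
  obtain ⟨Λ, hΛ⟩ := exists_boost_image_ball_disjoint_translates hr₀ hL
  refine ⟨Λ, hΛ, fun q ↦ ?_⟩
  set U : Opens E4 := ⟨ball (0 : E4) r₀, isOpen_ball⟩
  refine ⟨fun y : U ↦ q + (Λ : E4 ≃L[ℝ] E4) (y : E4), isLateChart_minkowski_affine r₀ Λ q,
    ⟨⟨0, mem_ball_self hr₀⟩, rfl, by simp⟩, ?_, ?_, ?_⟩
  · rw [deviationExtend_minkowski_affine, supCkENorm_zero]
  · rw [deviationExtend_minkowski_affine, supCkENorm_zero]
    exact zero_le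
  · ext x
    simp only [mem_range, mem_image, Subtype.exists, exists_prop]
    constructor
    · rintro ⟨a, ha, rfl⟩
      exact ⟨(Λ : E4 ≃L[ℝ] E4) a, ⟨a, ha, rfl⟩, rfl⟩
    · rintro ⟨y, ⟨a, ha, rfl⟩, rfl⟩
      exact ⟨a, ha, rfl⟩

end Summit.FinalStateConjecture.FinalStateConjecture.Theorems.ChannelsResolveTameDevelopmentsR.Negative

end
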